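import Mathlib
import Summits.AtomisticToContinuum.HydrodynamicLimit.Theorems.ImplosionDichotomyDenseExcursionPackingAnalyticDefsB
import Summits.AtomisticToContinuum.HydrodynamicLimit.Theorems.ImplosionDichotomyDenseExcursionSonicCavityDefsC

/-!
# Vocabulary of the line `packing-analytic-implosion`, part C (skeleton reshape v8; drafted by the wave-3 worker C of
# `stub_packingResolvent`, adopted by the lead a2 with the Option-B conjunct): the packing-order resolvent with the CENTRE-CORRECT weight

WHY. Clause (ii) of `PackingResolvent` (part B) — the weighted `C⁰ → C⁰` Laplace gain `|u₁| + |u₂|/S ≤ C·N/k` for ALL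
smooth centre-regular sources with `|f₁| + |f₂|/S ≤ N` — is FALSE for the pinned profile, uniformly in NO `k`: near the
centre the resolvent has an ACOUSTIC LAYER at the scale `R = eˣ ≍ s₀/(kμ)`. In the inner variable `ρ = kμ·R/s₀` the
leading-order system for `(u₁, V := kμ·u₂/S)` is `k`-FREE — the forced modified spherical Bessel equation
`V″ + (2/ρ)V′ − V = −g`, `u₁ = 3V_ρ/ρ`, `g = f₂/S` — so a source `f₂ = S·φ(kμ eˣ/s₀)` (a regular pair, weighted size
`sup φ = 1`) produces `sup |u₁| → sup|3V_ρ/ρ| = 0.367` (bump `φ` on `ρ ∈ (1, 3)`), independent of `k`, while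
`|u₂|/S ≈ 0.45/(kμ)` does gain (worker numerics `work/stubs/scratchC/num/inner_gain*.py`: full-profile Riccati sweep,
`Λ·sup|u₁| = 2.4, 4.2, 7.8, 15.1, 29.8` at `Λ = 5, 10, 20, 40, 80`; the `Λ`-free model reproduces the limits to 1–2%).
The gain IS true (numerically, constant `< 1` on the core for every tested family up to `Λ = 80`, including sources of
`w`-size `(1 + S)·N`) in the norm with the weight `1/(1 + S)` on the `w`-slot — `≍ eˣ` at the centre (where `u₁` of a
regular pair is bounded but the resolvent does not gain), `≍ 1` on the sonic window and in the far field: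
`‖(a, b)‖_S := sup (|a|/(1 + S) + |b|/S)`.

Contents: `PackingResolventW` (+ `packingResolventW_exists_solution`). NOT here: any proof.
-/

noncomputable section

open Filter Set
open scoped Topology ContDiff

namespace Summit.AtomisticToContinuum.HydrodynamicLimit.Theorems.PackingAnalyticImplosion

open Summit.AtomisticToContinuum.HydrodynamicLimit.Theorems.R2OneModeTwoConditions

/-- **THE PACKING-ORDER RESOLVENT WITH THE CENTRE-CORRECT WEIGHT** (proposed v8 replacement of `PackingResolvent`):
at every packing order `Λ = kμ`, `k ≥ 1`, every smooth centre-regular real source with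
`|f₁|/(1 + S) + |f₂|/S ≤ N` has a smooth centre-regular real solution of `kμ·u − Lu = f` with finite GLOBAL weighted sup
`|u₁| + |u₂|/S` (existence: `packingResolvent_existence`, p156607, after bounding the source globally by regularity), and
from some order `k₀` on the Laplace gain holds in the `(1 + S)`-weighted norm: `|u₁|/(1 + S) + |u₂|/S ≤ C·N/k`
everywhere, TOGETHER WITH (lead's addition, the worker's "Option B", measured `sup|u₁| ≤ 0.6N` for every tested family) the
`k`-uniform UNWEIGHTED bound `|u₁| ≤ C·N` for sources that are bounded in the unweighted norm `|f₁| + |f₂|/S ≤ N` (the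
`w`-component does not gain in the acoustic layer but stays `O(N)` there: `u₁ = 3V_ρ/ρ` of the `k`-free inner model). -/
def PackingResolventW (r : ℝ) (W S : ℝ → ℝ) : Prop :=
  ∃ (k₀ : ℕ) (C : ℝ), 0 < C ∧ ∀ k : ℕ, 1 ≤ k →
    ∀ f₁ f₂ : ℝ → ℝ, IsRegularPair (fun x => (f₁ x : ℂ)) (fun x => (f₂ x : ℂ)) →
      ∀ N : ℝ, (∀ y, |f₁ y| / (1 + S y) + |f₂ y| / S y ≤ N) →
        ∃ u₁ u₂ : ℝ → ℝ, IsRegularPair (fun x => (u₁ x : ℂ)) (fun x => (u₂ x : ℂ)) ∧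
          (∀ x, (((k : ℝ) * (3 * (r - 1)) : ℝ) : ℂ) * (u₁ x : ℂ) -
                linW r W S (fun y => (u₁ y : ℂ)) (fun y => (u₂ y : ℂ)) x = (f₁ x : ℂ) ∧
               (((k : ℝ) * (3 * (r - 1)) : ℝ) : ℂ) * (u₂ x : ℂ) -
                linS r W S (fun y => (u₁ y : ℂ)) (fun y => (u₂ y : ℂ)) x = (f₂ x : ℂ)) ∧
          (∃ N' : ℝ, ∀ y, |u₁ y| + |u₂ y| / S y ≤ N') ∧
          (k₀ ≤ k → (∀ y, |u₁ y| / (1 + S y) + |u₂ y| / S y ≤ C * N / k) ∧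
            ((∀ y, |f₁ y| + |f₂ y| / S y ≤ N) → ∀ y, |u₁ y| ≤ C * N))

/-- The existence half of `PackingResolventW` at one order, unpacked. [folklore] -/
theorem packingResolventW_exists_solution : ∀ {r : ℝ} {W S : ℝ → ℝ}, PackingResolventW r W S → ∀ {k : ℕ}, 1 ≤ k → ∀ {f₁ f₂ : ℝ → ℝ}, IsRegularPair (fun x => (f₁ x : ℂ)) (fun x => (f₂ x : ℂ)) → (∃ N : ℝ, ∀ y, |f₁ y| / (1 + S y) + |f₂ y| / S y ≤ N) → ∃ u₁ u₂ : ℝ → ℝ, IsRegularPair (fun x => (u₁ x : ℂ)) (fun x => (u₂ x : ℂ)) ∧ (∀ x, (((k : ℝ) * (3 * (r - 1)) : ℝ) : ℂ) * (u₁ x : ℂ) - linW r W S (fun y => (u₁ y : ℂ)) (fun y => (u₂ y : ℂ)) x = (f₁ x : ℂ) ∧ (((k : ℝ) * (3 * (r - 1)) : ℝ) : ℂ) * (u₂ x : ℂ) - linS r W S (fun y => (u₁ y : ℂ)) (fun y => (u₂ y : ℂ)) x = (f₂ x : ℂ)) ∧ ∃ N' : ℝ, ∀ y, |u₁ y| +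 |u₂ y| / S y ≤ N' := by
  intro r W S h k hk f₁ f₂ hf hN
  obtain ⟨k₀, C, -, hres⟩ := h
  obtain ⟨N, hN⟩ := hN
  obtain ⟨u₁, u₂, hu, hsol, hfin, -⟩ := hres k hk f₁ f₂ hf N hN
  exact ⟨u₁, u₂, hu, hsol, hfin⟩

end Summit.AtomisticToContinuum.HydrodynamicLimit.Theorems.PackingAnalyticImplosion

end
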